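import Mathlib
import Summits.Ventures.PercRepro2.Defs
import Summits.Ventures.PercRepro2.CoinDefs
import Summits.Ventures.PercRepro2.CoinArcsOff
import Summits.Ventures.PercRepro2.CoinPendantDefs
import Summits.Ventures.PercRepro2.CoinPathDefs

/-!
# The TRACE of the backward cluster on a pendant structure, and the two-vertex pendant head
(blind cell PercRepro2, night-2 g3; proofs/NIGHT2-DARC.md §16)

For a vertex set `P` (the pendant structure) let `D₀ = arcsOff arcs (P ∪ T)` be the reduced
system (every arc with tail in `P ∪ T` deleted) and let `Z = K⁻ ∩ P` be the TRACE of the backward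
cluster on `P`.  Then, pointwise in `ω`,
* `R_T = R^{D₀}_{T ∪ Z}` (`avoid_iff_trace`; no hypothesis on `P` at all — a path from `s` to `T`
  either lives in `D₀` or enters `P ∪ T` at a vertex that reaches `T`, i.e. at a vertex of `Z ∪ T`);
* when `P` is CLOSED OUT into `T` (`ClosedOut`: arcs with tails in `P` land in `P ∪ T`) and
  `u ∉ P ∪ T`: if `w ∈ Z` the gate event of the arc `u → w` is `R^{D₀}_{T ∪ Z ∪ {u}}`
  (`gate_iff_trace`), and if `w ∉ Z` it is `R_T` (`gate_eq_avoid_of_not_bwd`);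
* on `R_T` the markers `a ∉ P ∪ T` agree with the `D₀`-markers (`reach_iff_trace`).
For the TWO-VERTEX pendant head `P = {w, v}` the trace takes four values `∅, {v}, {w}, {w, v}`; the
four LEVEL events `lvl₀ … lvl₃` (which of `w`, `v` reach `T`) are defined here with their trace
descriptions (`trace_lvl₀ … trace_lvl₃`), the decompositions of `R_T` and of the gate event over
the levels (`avoid_eq_levels`, `gate_eq_levels`) and the identity of the trace SET
`{x | x ⇝ t} ∩ {w, v}` on each level (`traceSet_lvl₀ …`, single target `t`).
Used by `CoinTwoPendant.lean` (the theorem `darc_of_twoPendant_mixed`).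
-/

namespace Summit.Ventures.PercRepro2.Coin

section Trace

variable {V : Type*} {E : Type*} [DecidableEq V]

/-- **The trace identity for `R_T`** (general: any vertex set `P`, any configuration). If `Z ⊆ P`
is the set of vertices of `P` that reach `T` in `ω`, then `s ↛ T` iff `s ↛ Z ∪ T` in the reduced
system `D₀ = arcsOff arcs (P ∪ T)`. -/
lemma avoid_iff_trace {arcs : E → Finset (V × V)} {P T : Finset V} {s : V} {ω : Config E}
    {Z : Finset V} (hZ : Z ⊆ P) (htr : ∀ z ∈ P, z ∈ Z ↔ ω ∈ bwdEvent arcs z T) :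
    ω ∈ avoidEvent arcs s T ↔ ω ∈ avoidEvent (arcsOff arcs (P ∪ T)) s (Z ∪ T) := by
  constructor
  · intro hR t' ht' hr
    rw [Finset.mem_union] at ht'
    rcases ht' with hz | ht'
    · obtain ⟨t'', ht'', hzt⟩ := (htr t' (hZ hz)).mp hz
      exact hR t'' ht'' (reach_trans (reach_of_reach_arcsOff hr) hzt)
    · exact hR t' ht' (reach_of_reach_arcsOff hr)
  · intro hR t' ht' hr
    rcases reach_split' (P ∪ T) hr with h₀ | ⟨z, hz, hsz, hzt⟩
    · exact hR t' (Finset.mem_union_right _ ht') h₀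
    · rw [Finset.mem_union] at hz
      rcases hz with hz | hz
      · have hzZ : z ∈ Z := (htr z hz).mpr ⟨t', ht', hzt⟩
        exact hR z (Finset.mem_union_left _ hzZ) hsz
      · exact hR z (Finset.mem_union_right _ hz) hsz

/-- **The trace identity for the gate event** when the head `w` reaches `T` (`w ∈ Z`): for a
closed-out `P` and `u ∉ P ∪ T`, `{s ↛ T in D + (u → w)}` is `R^{D₀}_{T ∪ Z ∪ {u}}`. -/
lemma gate_iff_trace {arcs : E → Finset (V × V)} {P T : Finset V} (hclosed : ClosedOut arcs P T)
    {s u w : V} (hu : u ∉ P ∪ T) {ω : Config E} {Z : Finset V} (hZ : Z ⊆ P)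
    (htr : ∀ z ∈ P, z ∈ Z ↔ ω ∈ bwdEvent arcs z T) (hwP : w ∈ P) (hwZ : w ∈ Z) :
    ω ∈ gateEvent arcs s T u w ↔
      ω ∈ avoidEvent (arcsOff arcs (P ∪ T)) s (insert u (Z ∪ T)) := by
  have hG : ω ∈ bwdEvent arcs w T := (htr w hwP).mp hwZ
  have hRT : ω ∈ avoidEvent arcs s T ↔ ω ∈ avoidEvent (arcsOff arcs (P ∪ T)) s (Z ∪ T) :=
    avoid_iff_trace hZ htr
  rw [gateEvent_eq_union]
  simp only [Set.mem_inter_iff, Set.mem_union, Set.mem_compl_iff, hG, not_true_eq_false, or_false]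
  rw [hRT]
  constructor
  · rintro ⟨hR, hu'⟩ t' ht' hr
    rw [Finset.mem_insert] at ht'
    rcases ht' with rfl | ht'
    · exact hu' (reach_of_reach_arcsOff hr)
    · exact hR t' ht' hr
  · intro h
    refine ⟨fun t' ht' hr => h t' (Finset.mem_insert_of_mem ht') hr, fun hsu => ?_⟩
    rcases reach_split' (P ∪ T) hsu with h₀ | ⟨z, hz, hsz, hzu⟩
    · exact h u (Finset.mem_insert_self _ _) h₀
    · rw [Finset.mem_union] at hz
      rcases hz with hz | hz
      · rcases reach_from_pendant hclosed hz hzu with h₁ | ⟨t'', ht'', h₁⟩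
        · exact hu (reach_arcsOn_stay hclosed hz h₁)
        · have hzZ : z ∈ Z := (htr z hz).mpr ⟨t'', ht'', reach_of_reach_arcsOn h₁⟩
          exact h z (Finset.mem_insert_of_mem (Finset.mem_union_left _ hzZ)) hsz
      · exact h z (Finset.mem_insert_of_mem (Finset.mem_union_right _ hz)) hsz

/-- **Marker identity on `R_T`**: for a closed-out `P` and `a ∉ P ∪ T`, `s ⇝ a` iff `s ⇝ a` in the
reduced system (a path into `P` leaves it only into `T`). -/
lemma reach_iff_trace {arcs : E → Finset (V × V)} {P T : Finset V} (hclosed : ClosedOut arcs P T)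
    {s : V} {ω : Config E} (hR : ω ∈ avoidEvent arcs s T) {a : V} (ha : a ∉ P ∪ T) :
    Reach arcs ω s a ↔ Reach (arcsOff arcs (P ∪ T)) ω s a := by
  constructor
  · intro h
    rcases reach_split' (P ∪ T) h with h₀ | ⟨z, hz, hsz, hza⟩
    · exact h₀
    · rw [Finset.mem_union] at hz
      rcases hz with hz | hz
      · rcases reach_from_pendant hclosed hz hza with h₁ | ⟨t', ht', h₁⟩
        · exact absurd (reach_arcsOn_stay hclosed hz h₁) ha
        · exact absurd (reach_trans (reach_of_reach_arcsOff hsz) (reach_of_reach_arcsOn h₁))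
            (hR t' ht')
      · exact absurd (reach_of_reach_arcsOff hsz) (hR z hz)
  · exact reach_of_reach_arcsOff

end Trace

section Levels

variable {V : Type*} {E : Type*} [DecidableEq V]

/-- Level 0: neither `w` nor `v` reaches `T` (trace `∅`). -/
def lvl₀ (arcs : E → Finset (V × V)) (T : Finset V) (w v : V) : Set (Config E) :=
  (bwdEvent arcs w T)ᶜ ∩ (bwdEvent arcs v T)ᶜ

/-- Level 1: `v` reaches `T`, `w` does not (trace `{v}`). -/
def lvl₁ (arcs : E → Finset (V × V)) (T : Finset V) (w v : V) : Set (Config E) :=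
  (bwdEvent arcs w T)ᶜ ∩ bwdEvent arcs v T

/-- Level 2: `w` reaches `T`, `v` does not (trace `{w}`). -/
def lvl₂ (arcs : E → Finset (V × V)) (T : Finset V) (w v : V) : Set (Config E) :=
  bwdEvent arcs w T ∩ (bwdEvent arcs v T)ᶜ

/-- Level 3: both reach `T` (trace `{w, v}`). -/
def lvl₃ (arcs : E → Finset (V × V)) (T : Finset V) (w v : V) : Set (Config E) :=
  bwdEvent arcs w T ∩ bwdEvent arcs v T

variable {arcs : E → Finset (V × V)} {T : Finset V} {w v : V}

/-- The trace on level 0 is `∅`. -/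
lemma trace_lvl₀ {ω : Config E} (h : ω ∈ lvl₀ arcs T w v) :
    ∀ z ∈ ({w, v} : Finset V), z ∈ (∅ : Finset V) ↔ ω ∈ bwdEvent arcs z T := by
  intro z hz
  simp only [Finset.mem_insert, Finset.mem_singleton] at hz
  obtain ⟨hw, hv⟩ := h
  rcases hz with rfl | rfl
  · simp only [Finset.notMem_empty, false_iff]; exact hw
  · simp only [Finset.notMem_empty, false_iff]; exact hv

/-- The trace on level 1 is `{v}`. -/
lemma trace_lvl₁ (hwv : w ≠ v) {ω : Config E} (h : ω ∈ lvl₁ arcs T w v) :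
    ∀ z ∈ ({w, v} : Finset V), z ∈ ({v} : Finset V) ↔ ω ∈ bwdEvent arcs z T := by
  intro z hz
  simp only [Finset.mem_insert, Finset.mem_singleton] at hz
  obtain ⟨hw, hv⟩ := h
  rcases hz with rfl | rfl
  · simp only [Finset.mem_singleton, hwv, false_iff]; exact hw
  · simp only [Finset.mem_singleton, true_iff]; exact hv

/-- The trace on level 2 is `{w}`. -/
lemma trace_lvl₂ (hwv : w ≠ v) {ω : Config E} (h : ω ∈ lvl₂ arcs T w v) :
    ∀ z ∈ ({w, v} : Finset V), z ∈ ({w} : Finset V) ↔ ω ∈ bwdEvent arcs z T := by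
  intro z hz
  simp only [Finset.mem_insert, Finset.mem_singleton] at hz
  obtain ⟨hw, hv⟩ := h
  rcases hz with rfl | rfl
  · simp only [Finset.mem_singleton, true_iff]; exact hw
  · simp only [Finset.mem_singleton, hwv.symm, false_iff]; exact hv

/-- The trace on level 3 is `{w, v}`. -/
lemma trace_lvl₃ {ω : Config E} (h : ω ∈ lvl₃ arcs T w v) :
    ∀ z ∈ ({w, v} : Finset V), z ∈ ({w, v} : Finset V) ↔ ω ∈ bwdEvent arcs z T := by
  intro z hz
  simp only [Finset.mem_insert, Finset.mem_singleton] at hz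
  obtain ⟨hw, hv⟩ := h
  rcases hz with rfl | rfl
  · simp only [Finset.mem_insert, Finset.mem_singleton, true_or, true_iff]; exact hw
  · simp only [Finset.mem_insert, Finset.mem_singleton, or_true, true_iff]; exact hv

/-- The four levels cover everything and are pairwise disjoint: `R_T` decomposes as
`(L₀ ∩ R^{D₀}_T) ∪ (L₁ ∩ R^{D₀}_{T∪{v}}) ∪ (L₂ ∩ R^{D₀}_{T∪{w}}) ∪ (L₃ ∩ R^{D₀}_{T∪{w,v}})`. -/
theorem avoid_eq_levels (hwv : w ≠ v) (s : V) :
    avoidEvent arcs s T =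
      ((lvl₀ arcs T w v ∩ avoidEvent (arcsOff arcs ({w, v} ∪ T)) s T ∪
        lvl₁ arcs T w v ∩ avoidEvent (arcsOff arcs ({w, v} ∪ T)) s (insert v T)) ∪
       (lvl₂ arcs T w v ∩ avoidEvent (arcsOff arcs ({w, v} ∪ T)) s (insert w T) ∪
        lvl₃ arcs T w v ∩ avoidEvent (arcsOff arcs ({w, v} ∪ T)) s (insert w (insert v T)))) := by
  ext ω
  have e₀ : ∀ hω : ω ∈ lvl₀ arcs T w v, (ω ∈ avoidEvent arcs s T ↔
      ω ∈ avoidEvent (arcsOff arcs ({w, v} ∪ T)) s T) := fun hω => by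
    have := avoid_iff_trace (s := s) (Finset.empty_subset _) (trace_lvl₀ hω)
    rwa [Finset.empty_union] at this
  have e₁ : ∀ hω : ω ∈ lvl₁ arcs T w v, (ω ∈ avoidEvent arcs s T ↔
      ω ∈ avoidEvent (arcsOff arcs ({w, v} ∪ T)) s (insert v T)) := fun hω => by
    have := avoid_iff_trace (s := s) (by simp : ({v} : Finset V) ⊆ {w, v}) (trace_lvl₁ hwv hω)
    rwa [Finset.singleton_union] at this
  have e₂ : ∀ hω : ω ∈ lvl₂ arcs T w v, (ω ∈ avoidEvent arcs s T ↔
      ω ∈ avoidEvent (arcsOff arcs ({w, v} ∪ T)) s (insert w T)) := fun hω => by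
    have := avoid_iff_trace (s := s) (by simp : ({w} : Finset V) ⊆ {w, v}) (trace_lvl₂ hwv hω)
    rwa [Finset.singleton_union] at this
  have e₃ : ∀ hω : ω ∈ lvl₃ arcs T w v, (ω ∈ avoidEvent arcs s T ↔
      ω ∈ avoidEvent (arcsOff arcs ({w, v} ∪ T)) s (insert w (insert v T))) := fun hω => by
    have hZT : ({w, v} : Finset V) ∪ T = insert w (insert v T) := by
      rw [Finset.insert_union, Finset.singleton_union]
    have := avoid_iff_trace (s := s) (Finset.Subset.refl _) (trace_lvl₃ hω)
    rw [hZT] at this ⊢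
    exact this
  simp only [Set.mem_union, Set.mem_inter_iff]
  by_cases hw : ω ∈ bwdEvent arcs w T <;> by_cases hv : ω ∈ bwdEvent arcs v T
  · have hl : ω ∈ lvl₃ arcs T w v := ⟨hw, hv⟩
    have hn₀ : ω ∉ lvl₀ arcs T w v := fun h => h.1 hw
    have hn₁ : ω ∉ lvl₁ arcs T w v := fun h => h.1 hw
    have hn₂ : ω ∉ lvl₂ arcs T w v := fun h => h.2 hv
    simp only [hl, hn₀, hn₁, hn₂, false_and, false_or, or_false, true_and]
    exact e₃ hl
  · have hl : ω ∈ lvl₂ arcs T w v := ⟨hw, hv⟩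
    have hn₀ : ω ∉ lvl₀ arcs T w v := fun h => h.1 hw
    have hn₁ : ω ∉ lvl₁ arcs T w v := fun h => h.1 hw
    have hn₃ : ω ∉ lvl₃ arcs T w v := fun h => hv h.2
    simp only [hl, hn₀, hn₁, hn₃, false_and, false_or, or_false, true_and]
    exact e₂ hl
  · have hl : ω ∈ lvl₁ arcs T w v := ⟨hw, hv⟩
    have hn₀ : ω ∉ lvl₀ arcs T w v := fun h => h.2 hv
    have hn₂ : ω ∉ lvl₂ arcs T w v := fun h => hw h.1
    have hn₃ : ω ∉ lvl₃ arcs T w v := fun h => hw h.1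
    simp only [hl, hn₀, hn₂, hn₃, false_and, false_or, or_false, true_and]
    exact e₁ hl
  · have hl : ω ∈ lvl₀ arcs T w v := ⟨hw, hv⟩
    have hn₁ : ω ∉ lvl₁ arcs T w v := fun h => hv h.2
    have hn₂ : ω ∉ lvl₂ arcs T w v := fun h => hw h.1
    have hn₃ : ω ∉ lvl₃ arcs T w v := fun h => hw h.1
    simp only [hl, hn₁, hn₂, hn₃, false_and, or_false, true_and]
    exact e₀ hl

/-- The gate event decomposes over the four levels: on the levels where `w ↛ T` it is `R_T`, on the
other two it is the reduced avoidance event with `u` added. -/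
theorem gate_eq_levels (hclosed : ClosedOut arcs {w, v} T) (hwv : w ≠ v) (s : V) {u : V}
    (hu : u ∉ ({w, v} : Finset V) ∪ T) :
    gateEvent arcs s T u w =
      ((lvl₀ arcs T w v ∩ avoidEvent (arcsOff arcs ({w, v} ∪ T)) s T ∪
        lvl₁ arcs T w v ∩ avoidEvent (arcsOff arcs ({w, v} ∪ T)) s (insert v T)) ∪
       (lvl₂ arcs T w v ∩ avoidEvent (arcsOff arcs ({w, v} ∪ T)) s (insert u (insert w T)) ∪
        lvl₃ arcs T w v ∩
          avoidEvent (arcsOff arcs ({w, v} ∪ T)) s (insert u (insert w (insert v T))))) := by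
  ext ω
  have hwP : w ∈ ({w, v} : Finset V) := by simp
  have e₀ : ∀ hω : ω ∈ lvl₀ arcs T w v, (ω ∈ gateEvent arcs s T u w ↔
      ω ∈ avoidEvent (arcsOff arcs ({w, v} ∪ T)) s T) := fun hω => by
    have := avoid_iff_trace (s := s) (Finset.empty_subset _) (trace_lvl₀ hω)
    rw [Finset.empty_union] at this
    exact (gate_eq_avoid_of_not_bwd hω.1).trans this
  have e₁ : ∀ hω : ω ∈ lvl₁ arcs T w v, (ω ∈ gateEvent arcs s T u w ↔
      ω ∈ avoidEvent (arcsOff arcs ({w, v} ∪ T)) s (insert v T)) := fun hω => by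
    have := avoid_iff_trace (s := s) (by simp : ({v} : Finset V) ⊆ {w, v}) (trace_lvl₁ hwv hω)
    rw [Finset.singleton_union] at this
    exact (gate_eq_avoid_of_not_bwd hω.1).trans this
  have e₂ : ∀ hω : ω ∈ lvl₂ arcs T w v, (ω ∈ gateEvent arcs s T u w ↔
      ω ∈ avoidEvent (arcsOff arcs ({w, v} ∪ T)) s (insert u (insert w T))) := fun hω => by
    have := gate_iff_trace hclosed (s := s) hu (by simp : ({w} : Finset V) ⊆ {w, v})
      (trace_lvl₂ hwv hω) hwP (Finset.mem_singleton_self w)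
    rwa [Finset.singleton_union] at this
  have e₃ : ∀ hω : ω ∈ lvl₃ arcs T w v, (ω ∈ gateEvent arcs s T u w ↔
      ω ∈ avoidEvent (arcsOff arcs ({w, v} ∪ T)) s (insert u (insert w (insert v T)))) :=
    fun hω => by
    have hZT : ({w, v} : Finset V) ∪ T = insert w (insert v T) := by
      rw [Finset.insert_union, Finset.singleton_union]
    have := gate_iff_trace hclosed (s := s) hu (Finset.Subset.refl _) (trace_lvl₃ hω) hwP hwP
    rw [hZT] at this ⊢
    exact this
  simp only [Set.mem_union, Set.mem_inter_iff]
  by_cases hw : ω ∈ bwdEvent arcs w T <;> by_cases hv : ω ∈ bwdEvent arcs v T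
  · have hl : ω ∈ lvl₃ arcs T w v := ⟨hw, hv⟩
    have hn₀ : ω ∉ lvl₀ arcs T w v := fun h => h.1 hw
    have hn₁ : ω ∉ lvl₁ arcs T w v := fun h => h.1 hw
    have hn₂ : ω ∉ lvl₂ arcs T w v := fun h => h.2 hv
    simp only [hl, hn₀, hn₁, hn₂, false_and, false_or, or_false, true_and]
    exact e₃ hl
  · have hl : ω ∈ lvl₂ arcs T w v := ⟨hw, hv⟩
    have hn₀ : ω ∉ lvl₀ arcs T w v := fun h => h.1 hw
    have hn₁ : ω ∉ lvl₁ arcs T w v := fun h => h.1 hw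
    have hn₃ : ω ∉ lvl₃ arcs T w v := fun h => hv h.2
    simp only [hl, hn₀, hn₁, hn₃, false_and, false_or, or_false, true_and]
    exact e₂ hl
  · have hl : ω ∈ lvl₁ arcs T w v := ⟨hw, hv⟩
    have hn₀ : ω ∉ lvl₀ arcs T w v := fun h => h.2 hv
    have hn₂ : ω ∉ lvl₂ arcs T w v := fun h => hw h.1
    have hn₃ : ω ∉ lvl₃ arcs T w v := fun h => hw h.1
    simp only [hl, hn₀, hn₂, hn₃, false_and, false_or, or_false, true_and]
    exact e₁ hl
  · have hl : ω ∈ lvl₀ arcs T w v := ⟨hw, hv⟩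
    have hn₁ : ω ∉ lvl₁ arcs T w v := fun h => hv h.2
    have hn₂ : ω ∉ lvl₂ arcs T w v := fun h => hw h.1
    have hn₃ : ω ∉ lvl₃ arcs T w v := fun h => hw h.1
    simp only [hl, hn₁, hn₂, hn₃, false_and, or_false, true_and]
    exact e₀ hl

/-- `{s ↛ t, w ↛ t}` (the avoidance event of `{s, w}` in the T-frame) is `R_T` minus the levels
where `w` reaches `T`. -/
lemma avoid_sw_eq {t : V} (s : V) :
    {ω : Config E | ∀ x ∈ insert s ({w} : Finset V), ¬ Reach arcs ω x t} =
      avoidEvent arcs s {t} ∩ (bwdEvent arcs w {t})ᶜ := by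
  ext ω
  simp only [Set.mem_setOf_eq, Finset.mem_insert, Finset.mem_singleton, forall_eq_or_imp,
    forall_eq, Set.mem_inter_iff, avoidEvent, Set.mem_compl_iff, bwdEvent, exists_eq_left]

/-- `{s ↛ t}` (the avoidance event of `{s}` in the T-frame) is `R_T`. -/
lemma avoid_s_eq {t : V} (s : V) :
    {ω : Config E | ∀ x ∈ insert s (∅ : Finset V), ¬ Reach arcs ω x t} =
      avoidEvent arcs s {t} := by
  ext ω
  simp only [Set.mem_setOf_eq, Finset.insert_empty, Finset.mem_singleton, forall_eq, avoidEvent]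

/-- `R_T ∩ {w ∉ K⁻}` is the union of the two levels where `w ↛ T`. -/
theorem avoid_inter_compl_eq_levels (hwv : w ≠ v) (s : V) :
    avoidEvent arcs s T ∩ (bwdEvent arcs w T)ᶜ =
      lvl₀ arcs T w v ∩ avoidEvent (arcsOff arcs ({w, v} ∪ T)) s T ∪
        lvl₁ arcs T w v ∩ avoidEvent (arcsOff arcs ({w, v} ∪ T)) s (insert v T) := by
  rw [avoid_eq_levels hwv s]
  ext ω
  simp only [Set.mem_inter_iff, Set.mem_union, Set.mem_compl_iff]
  constructor
  · rintro ⟨h, hw⟩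
    rcases h with (h | h) | (h | h)
    · exact Or.inl h
    · exact Or.inr h
    · exact absurd h.1.1 hw
    · exact absurd h.1.1 hw
  · rintro (h | h)
    · exact ⟨Or.inl (Or.inl h), h.1.1⟩
    · exact ⟨Or.inl (Or.inr h), h.1.1⟩

end Levels

section TraceSet

variable {V : Type*} {E : Type*} {arcs : E → Finset (V × V)} {w v : V}

/-- The trace SET of a single target `t`: `{x | x ⇝ t} ∩ {w, v}` is `∅` on level 0. -/
lemma traceSet_lvl₀ {t : V} {ω : Config E} (h : ω ∈ lvl₀ arcs {t} w v) :
    {x | Reach arcs ω x t} ∩ ({w, v} : Set V) = ∅ := by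
  obtain ⟨hw, hv⟩ := h
  simp only [bwdEvent, Finset.mem_singleton, exists_eq_left] at hw hv
  ext x
  simp only [Set.mem_inter_iff, Set.mem_setOf_eq, Set.mem_insert_iff, Set.mem_singleton_iff,
    Set.mem_empty_iff_false, iff_false, not_and]
  rintro hx (rfl | rfl)
  · exact hw hx
  · exact hv hx

/-- The trace set is `{v}` on level 1. -/
lemma traceSet_lvl₁ (hwv : w ≠ v) {t : V} {ω : Config E} (h : ω ∈ lvl₁ arcs {t} w v) :
    {x | Reach arcs ω x t} ∩ ({w, v} : Set V) = {v} := by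
  obtain ⟨hw, hv⟩ := h
  simp only [bwdEvent, Finset.mem_singleton, exists_eq_left] at hw hv
  ext x
  simp only [Set.mem_inter_iff, Set.mem_setOf_eq, Set.mem_insert_iff, Set.mem_singleton_iff]
  constructor
  · rintro ⟨hx, rfl | rfl⟩
    · exact absurd hx hw
    · rfl
  · rintro rfl
    exact ⟨hv, Or.inr rfl⟩

/-- The trace set is `{w}` on level 2. -/
lemma traceSet_lvl₂ (hwv : w ≠ v) {t : V} {ω : Config E} (h : ω ∈ lvl₂ arcs {t} w v) :
    {x | Reach arcs ω x t} ∩ ({w, v} : Set V) = {w} := by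
  obtain ⟨hw, hv⟩ := h
  simp only [bwdEvent, Finset.mem_singleton, exists_eq_left] at hw hv
  ext x
  simp only [Set.mem_inter_iff, Set.mem_setOf_eq, Set.mem_insert_iff, Set.mem_singleton_iff]
  constructor
  · rintro ⟨hx, rfl | rfl⟩
    · rfl
    · exact absurd hx hv
  · rintro rfl
    exact ⟨hw, Or.inl rfl⟩

/-- The trace set is `{w, v}` on level 3. -/
lemma traceSet_lvl₃ {t : V} {ω : Config E} (h : ω ∈ lvl₃ arcs {t} w v) :
    {x | Reach arcs ω x t} ∩ ({w, v} : Set V) = {w, v} := by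
  obtain ⟨hw, hv⟩ := h
  simp only [bwdEvent, Finset.mem_singleton, exists_eq_left] at hw hv
  ext x
  simp only [Set.mem_inter_iff, Set.mem_setOf_eq, Set.mem_insert_iff, Set.mem_singleton_iff]
  constructor
  · rintro ⟨_, hx⟩; exact hx
  · rintro (rfl | rfl)
    · exact ⟨hw, Or.inl rfl⟩
    · exact ⟨hv, Or.inr rfl⟩

end TraceSet

end Summit.Ventures.PercRepro2.Coin
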